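import Mathlib
import Summits.Ventures.PercRepro2.LocRows
import Summits.Ventures.PercRepro2.SwRow
import Summits.Ventures.PercRepro2.SwOut
import Summits.Ventures.PercRepro2.SwAllRow
import Summits.Ventures.PercRepro2.SwOutAll
import Summits.Ventures.PercRepro2.SwOutArmFlip
import Summits.Ventures.PercRepro2.SwOutArms
import Summits.Ventures.PercRepro2.SwOutArmOrbit
import Summits.Ventures.PercRepro2.SwOutArmCube
import Summits.Ventures.PercRepro2.SwOutArmThm
import Summits.Ventures.PercRepro2.SwOutCoreDefs
import Summits.Ventures.PercRepro2.SwOutCoreHull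
import Summits.Ventures.PercRepro2.SwOutCoreDual
import Summits.Ventures.PercRepro2.SwOutShadowDefs
import Summits.Ventures.PercRepro2.SwOutShadowCube
import Summits.Ventures.PercRepro2.SwOutCoreShadowDefs
import Summits.Ventures.PercRepro2.SwOutCoreShadow
import Summits.Ventures.PercRepro2.SwOutCoreShadowFlip
import Summits.Ventures.PercRepro2.SwOutCoreToggle
import Summits.Ventures.PercRepro2.SwOutCoreShadowArm

/-!
# Orbit points are flips of unions of coarse arms (blind cell PercRepro2, night-4 g14,
2026-08-26; proofs/NIGHT4-G14.md §4)

The coarse orbit of a core-free configuration `ζ'` (the arm principle's `orbit (allRed ζ' h) h`)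
consists of the flips of unions of coarse arms of `ζ'` (`exists_armsUnion_of_mem_orbit`):
flips of unions of coarse arms compose to the flip of the symmetric difference
(`flip_armsUnion_flip_armsUnion`).  At a point whose coarse arms are `sX` and the far arms of a
core base (`SwOutCoreShadowArm`), such a union is `sX` (or nothing) together with a selection of
far arms (`armsUnion_eq`, `flip_armsUnion_eq`), and a far selection is a shadow selection
(`shadowSel_far_eq`).  Also: the data `sX`, `sZ`, `sB`, `shadowOf`, `uRed` depend only on the
u-adjacent coordinates (`sX_congr`, …), and a shadow point / a one-sided core point is core-free.
-/

namespace Summit.Ventures.PercRepro2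

namespace LocRows

open Hull

variable {V : Type*} {E : Type*} [Fintype E] [DecidableEq E]

open scoped Classical

variable {ends : E → Sym2 V}

section Union

variable {h : V}

/-- The union of the members of `𝒜` satisfying `p`. -/
def armsUnion (𝒜 : Finset (Set V)) (p : Set V → Prop) : Set V := {x | ∃ P ∈ 𝒜, p P ∧ x ∈ P}

omit [Fintype E] [DecidableEq E] in
/-- Membership in a union of arms. -/
lemma mem_armsUnion_iff {𝒜 : Finset (Set V)} {p : Set V → Prop} {x : V} :
    x ∈ armsUnion 𝒜 p ↔ ∃ P ∈ 𝒜, p P ∧ x ∈ P := Iff.rfl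

omit [DecidableEq E] in
/-- The arms assigned `false` by a cube point form a union of arms. -/
lemma armsFalse_eq_armsUnion (ζ₀ : Config E) (ω : Config (arms ends ζ₀ h)) :
    armsFalse ends ζ₀ h ω =
      armsUnion (arms ends ζ₀ h) fun P => ∃ hP : P ∈ arms ends ζ₀ h, ω ⟨P, hP⟩ = false := by
  ext x
  simp only [armsFalse, armsUnion, Set.mem_setOf_eq]
  constructor
  · rintro ⟨P, hP, hx⟩
    exact ⟨P.1, P.2, ⟨P.2, hP⟩, hx⟩
  · rintro ⟨P, hP, ⟨_, hω⟩, hx⟩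
    exact ⟨⟨P, hP⟩, hω, hx⟩

omit [DecidableEq E] in
/-- An edge with an end in a coarse arm `P` touches the union `armsUnion p` iff `p P`. -/
lemma mem_touches_armsUnion_iff {η : Config E} {P : Set V} (hP : P ∈ arms ends η h)
    {p : Set V → Prop} {e : E} {x y : V} (hxy : ends e = s(x, y)) (hx : x ∈ P) :
    e ∈ touches ends (armsUnion (arms ends η h) p) ↔ p P := by
  constructor
  · rintro ⟨z, ⟨P', hP', hpP', hzP'⟩, w, hzw⟩
    rw [hxy, Sym2.eq_iff] at hzw
    rcases hzw with ⟨h1, _⟩ | ⟨_, h2⟩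
    · rw [← h1] at hzP'
      rw [arms_eq_of_mem hP hP' hx hzP']
      exact hpP'
    · rw [← h2] at hzP'
      have hyH := mem_hull_sdiff_of_mem_arms hP' hzP'
      have hyP : y ∈ P := (armClosed_of_mem_arms hP).closed e x y hxy hx hyH.1 hyH.2
      rw [arms_eq_of_mem hP hP' hyP hzP']
      exact hpP'
  · intro hp
    exact ⟨x, ⟨P, hP, hp, hx⟩, y, hxy⟩

omit [DecidableEq E] in
/-- An edge with no end in a coarse arm touches no union of arms. -/
lemma not_mem_touches_armsUnion {η : Config E} {p : Set V → Prop} {e : E}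
    (he : ∀ P ∈ arms ends η h, ∀ x ∈ P, x ∉ ends e) :
    e ∉ touches ends (armsUnion (arms ends η h) p) := by
  rintro ⟨z, ⟨P, hP, _, hzP⟩, w, hzw⟩
  exact he P hP z hzP (by rw [hzw]; exact Sym2.mem_mk_left z w)

omit [DecidableEq E] in
/-- **Flips of unions of coarse arms compose to the flip of the symmetric difference.** -/
theorem flip_armsUnion_flip_armsUnion (η : Config E) (p q : Set V → Prop) (ρ : Config E) :
    flip ends (armsUnion (arms ends η h) p) (flip ends (armsUnion (arms ends η h) q) ρ) =
      flip ends (armsUnion (arms ends η h) fun P => Xor (p P) (q P)) ρ := by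
  funext e
  by_cases he : ∃ P ∈ arms ends η h, ∃ x ∈ P, ∃ y, ends e = s(x, y)
  · obtain ⟨P, hP, x, hx, y, hxy⟩ := he
    have hp := mem_touches_armsUnion_iff hP (p := p) hxy hx
    have hq := mem_touches_armsUnion_iff hP (p := q) hxy hx
    have hpq := mem_touches_armsUnion_iff hP (p := fun P => Xor (p P) (q P)) hxy hx
    by_cases hpP : p P <;> by_cases hqP : q P
    · rw [flip_apply_of_mem (hp.2 hpP), flip_apply_of_mem (hq.2 hqP), flip_apply_of_notMem
        (fun h' => by
          rcases hpq.1 h' with ⟨_, h2⟩ | ⟨_, h2⟩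
          · exact h2 hqP
          · exact h2 hpP), Bool.not_not]
    · rw [flip_apply_of_mem (hp.2 hpP), flip_apply_of_notMem (fun h' => hqP (hq.1 h')),
        flip_apply_of_mem (hpq.2 (show Xor _ _ from Or.inl ⟨hpP, hqP⟩))]
    · rw [flip_apply_of_notMem (fun h' => hpP (hp.1 h')), flip_apply_of_mem (hq.2 hqP),
        flip_apply_of_mem (hpq.2 (show Xor _ _ from Or.inr ⟨hqP, hpP⟩))]
    · rw [flip_apply_of_notMem (fun h' => hpP (hp.1 h')),
        flip_apply_of_notMem (fun h' => hqP (hq.1 h')),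
        flip_apply_of_notMem (fun h' => by
          rcases hpq.1 h' with ⟨h1, _⟩ | ⟨h1, _⟩
          · exact hpP h1
          · exact hqP h1)]
  · have hn : ∀ P ∈ arms ends η h, ∀ x ∈ P, x ∉ ends e := by
      intro P hP x hx hxe
      exact he ⟨P, hP, x, hx, Sym2.Mem.other hxe, (Sym2.other_spec hxe).symm⟩
    rw [flip_apply_of_notMem (not_mem_touches_armsUnion hn),
      flip_apply_of_notMem (not_mem_touches_armsUnion hn),
      flip_apply_of_notMem (not_mem_touches_armsUnion hn)]

omit [DecidableEq E] in
/-- Two points of a coarse orbit differ by the flip of a union of coarse arms. -/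
theorem orbitReal_eq_flip_armsUnion_orbitReal (ζ₀ : Config E) (ω ω' : Config (arms ends ζ₀ h)) :
    ∃ q : Set V → Prop,
      orbitReal ends ζ₀ h ω = flip ends (armsUnion (arms ends ζ₀ h) q) (orbitReal ends ζ₀ h ω') := by
  obtain ⟨p, hp⟩ : ∃ p, armsFalse ends ζ₀ h ω = armsUnion (arms ends ζ₀ h) p :=
    ⟨_, armsFalse_eq_armsUnion ζ₀ ω⟩
  obtain ⟨p', hp'⟩ : ∃ p, armsFalse ends ζ₀ h ω' = armsUnion (arms ends ζ₀ h) p :=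
    ⟨_, armsFalse_eq_armsUnion ζ₀ ω'⟩
  refine ⟨fun P => Xor (p P) (p' P), ?_⟩
  unfold orbitReal
  rw [hp, hp', ← flip_armsUnion_flip_armsUnion, Hull.flip_flip]

omit [DecidableEq E] in
/-- **Every point of the coarse orbit of a core-free configuration is the flip of a union of
its coarse arms.** -/
theorem exists_armsUnion_of_mem_orbit {ζ' : Config E} (hc' : CoreFree ends ζ' h) {ζ'' : Config E}
    (hζ'' : ζ'' ∈ orbit ends (allRed ends ζ' h) h) :
    ∃ p : Set V → Prop, ζ'' = flip ends (armsUnion (arms ends ζ' h) p) ζ' := by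
  have harms : arms ends (allRed ends ζ' h) h = arms ends ζ' h :=
    arms_eq_of_hull_eq (hull_allRed hc')
  simp only [orbit, Finset.mem_image, Finset.mem_univ, true_and] at hζ''
  obtain ⟨ω, rfl⟩ := hζ''
  obtain ⟨ω', hω'⟩ := exists_orbitReal_eq (ζ₀ := allRed ends ζ' h) hc' rfl
  obtain ⟨q, hq⟩ := orbitReal_eq_flip_armsUnion_orbitReal (allRed ends ζ' h) ω ω'
  rw [hω', harms] at hq
  exact ⟨q, hq⟩

end Union

/-! ## Congruences in the u-adjacent coordinates -/

section Congr

variable {ι : Type*} {A : ι → Set V} {pure : ι → Prop} {u : V} {ω ω' : Config ι}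
  (hωω' : ∀ i, uAdjC ends u A i → ω i = ω' i)
include hωω'

omit [Fintype E] [DecidableEq E] in
/-- `sX` depends on the u-adjacent coordinates only. -/
lemma sX_congr : sX ends u A ω = sX ends u A ω' := by
  ext x
  simp only [sX, Set.mem_union, Set.mem_singleton_iff, Set.mem_setOf_eq]
  constructor
  · rintro (rfl | ⟨i, hi, hω, hx⟩)
    · exact Or.inl rfl
    · exact Or.inr ⟨i, hi, by rw [← hωω' i hi]; exact hω, hx⟩
  · rintro (rfl | ⟨i, hi, hω, hx⟩)
    · exact Or.inl rfl
    · exact Or.inr ⟨i, hi, by rw [hωω' i hi]; exact hω, hx⟩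

omit [Fintype E] [DecidableEq E] in
/-- `sZ` depends on the u-adjacent coordinates only. -/
lemma sZ_congr : sZ ends u A ω = sZ ends u A ω' := by
  ext x
  simp only [sZ, Set.mem_setOf_eq]
  constructor
  · rintro ⟨i, hi, hω, hx⟩
    exact ⟨i, hi, by rw [← hωω' i hi]; exact hω, hx⟩
  · rintro ⟨i, hi, hω, hx⟩
    exact ⟨i, hi, by rw [hωω' i hi]; exact hω, hx⟩

omit [Fintype E] [DecidableEq E] in
/-- `sB` depends on the u-adjacent coordinates only. -/
lemma sB_congr : sB ends u A ω = sB ends u A ω' := by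
  funext j
  rcases j with _ | i
  · simp only [sB]; exact sX_congr hωω'
  · rfl

omit [Fintype E] [DecidableEq E] in
/-- The shadow base depends on the u-adjacent coordinates only. -/
lemma shadowOf_congr (ζ : Config E) : shadowOf ends u A ω ζ = shadowOf ends u A ω' ζ := by
  unfold shadowOf
  rw [sZ_congr hωω']

omit [Fintype E] [DecidableEq E] in
/-- `uRed` depends on the u-adjacent coordinates only. -/
lemma uRed_congr : uRed ends A u pure ω ↔ uRed ends A u pure ω' := by
  constructor
  · rintro ⟨i, hi, hpi, e, x, hux, hx⟩
    exact ⟨i, by rw [← hωω' i ⟨e, x, hux, hx⟩]; exact hi, hpi, e, x, hux, hx⟩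
  · rintro ⟨i, hi, hpi, e, x, hux, hx⟩
    exact ⟨i, by rw [hωω' i ⟨e, x, hux, hx⟩]; exact hi, hpi, e, x, hux, hx⟩

omit [Fintype E] [DecidableEq E] in
/-- `flipAll` preserves agreement on the u-adjacent coordinates. -/
lemma flipAll_congr : ∀ i, uAdjC ends u A i → flipAll ω i = flipAll ω' i := by
  intro i hi
  simp only [flipAll, hωω' i hi]

end Congr

/-! ## Decomposition of a union of coarse arms -/

section Decomp

variable {ι : Type*} {A : ι → Set V} {pure : ι → Prop} {ζ : Config E} {h u : V} {H : Set V}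
  (hb : CoreBase ends ζ h u H A pure) {ω₀ : Config ι} (hconn : ArmsConnected A ends)
  {η : Config E} (hH : hull ends η h = {h} ∪ {x | ∃ j, x ∈ sB ends u A ω₀ j})
include hb hconn hH

/-- The far selection of a predicate on arms. -/
def farSel (ends : E → Sym2 V) (u : V) (A : ι → Set V) (p : Set V → Prop) : Set V :=
  armsSel A fun i => ¬ uAdjC ends u A i ∧ p (A i)

omit [DecidableEq E] in
/-- **A union of coarse arms is `sX` (or nothing) with a far selection.** -/
theorem armsUnion_eq (p : Set V → Prop) :
    armsUnion (arms ends η h) p =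
      {x | p (sX ends u A ω₀) ∧ x ∈ sX ends u A ω₀} ∪ farSel ends u A p := by
  ext x
  simp only [armsUnion, farSel, armsSel, Set.mem_union, Set.mem_setOf_eq]
  constructor
  · rintro ⟨P, hP, hpP, hxP⟩
    obtain ⟨j, rfl⟩ := hb.exists_sB_of_mem_arms hconn hH hP
    rcases j with _ | ⟨i, hi⟩
    · exact Or.inl ⟨hpP, hxP⟩
    · exact Or.inr ⟨i, ⟨hi, hpP⟩, hxP⟩
  · rintro (⟨hpX, hx⟩ | ⟨i, ⟨hi, hpi⟩, hx⟩)
    · exact ⟨_, hb.sX_mem_arms hconn hH, hpX, hx⟩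
    · exact ⟨_, hb.far_mem_arms hconn hH hi, hpi, hx⟩

omit [Fintype E] [DecidableEq E] hconn in
/-- No edge joins `sX` to a far selection. -/
lemma CoreBase.not_touches_sX_farSel (p : Set V → Prop) {e : E}
    (hX : e ∈ touches ends (sX ends u A ω₀)) (hF : e ∈ touches ends (farSel ends u A p)) : False := by
  obtain ⟨x, hx, y, hxy⟩ := hX
  obtain ⟨z, ⟨i, ⟨hi, _⟩, hzi⟩, w, hzw⟩ := hF
  rw [hxy, Sym2.eq_iff] at hzw
  rcases hzw with ⟨h1, _⟩ | ⟨_, h2⟩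
  · rw [← h1] at hzi
    rcases mem_sX_iff.1 hx with rfl | ⟨i', hi', _, hxi'⟩
    · exact hb.u_notMem_arm i hzi
    · exact hi (by
        have : i' = i := by
          by_contra hne
          exact hb.arm_disj i' i hne x hxi' hzi
        subst this; exact hi')
  · rw [← h2] at hzi
    exact hb.no_edge_sX_far hH hxy hx hi hzi

omit [DecidableEq E] in
/-- **The flip of a union of coarse arms**: the far selection after `sX` (when selected). -/
theorem flip_armsUnion_eq (p : Set V → Prop) (ρ : Config E) :
    flip ends (armsUnion (arms ends η h) p) ρ =
      flip ends (farSel ends u A p) (if p (sX ends u A ω₀) then flip ends (sX ends u A ω₀) ρ else ρ) := by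
  rw [armsUnion_eq hb hconn hH]
  by_cases hpX : p (sX ends u A ω₀)
  · have hset : {x | p (sX ends u A ω₀) ∧ x ∈ sX ends u A ω₀} = sX ends u A ω₀ := by
      ext x; simp [hpX]
    rw [hset, if_pos hpX, flip_union_of_not_both]
    · exact flip_comm _ _ _
    · exact fun e hX hF => hb.not_touches_sX_farSel hH p hX hF
  · have hset : {x | p (sX ends u A ω₀) ∧ x ∈ sX ends u A ω₀} = (∅ : Set V) := by
      ext x; simp [hpX]
    rw [hset, if_neg hpX, Set.empty_union]

omit [Fintype E] [DecidableEq E] hb hconn hH in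
/-- A far selection is a shadow selection with `none` unselected. -/
lemma shadowSel_far_eq (p : Set V → Prop) :
    shadowSel (sB ends u A ω₀) (sZ ends u A ω₀) none
      (fun j => ∃ i : {i : ι // ¬ uAdjC ends u A i}, j = some i ∧ p (A i.1)) =
      farSel ends u A p := by
  ext x
  simp only [shadowSel, farSel, armsSel, Set.mem_union, Set.mem_setOf_eq]
  constructor
  · rintro (⟨j, ⟨i, rfl, hpi⟩, hx⟩ | ⟨⟨i, hi, _⟩, _⟩)
    · exact ⟨i.1, ⟨i.2, hpi⟩, hx⟩
    · exact absurd hi (by simp)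
  · rintro ⟨i, ⟨hi, hpi⟩, hx⟩
    exact Or.inl ⟨some ⟨i, hi⟩, ⟨⟨i, hi⟩, rfl, hpi⟩, hx⟩

end Decomp

/-! ## Core-freeness -/

section CoreFree

variable {ι : Type*} {A : ι → Set V} {pure : ι → Prop} {ζ : Config E} {h u : V} {H : Set V}

omit [Fintype E] [DecidableEq E] in
/-- A shadow point is core-free. -/
theorem ShadowBase.coreFree_shadowReal {κ : Type*} {B : κ → Set V} {Z : Set V} {k₀ : κ}
    {σ : Config E} (hs : ShadowBase ends σ h Z B k₀) (ω : Config κ) :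
    CoreFree ends (shadowReal ends B Z k₀ σ ω) h := by
  intro x hx hx'
  rw [hs.cluster_shadowReal, mem_sRed_iff] at hx
  rw [hs.cluster_blue_shadowReal, mem_sRed_iff] at hx'
  rcases hx with rfl | ⟨j, hj, hxj⟩
  · rfl
  rcases hx' with rfl | ⟨j', hj', hxj'⟩
  · rfl
  exfalso
  have : j = j' := by
    by_contra hne
    exact hs.B_disj j j' hne x hxj hxj'
  subst this
  simp only [flipAll, hj] at hj'
  exact absurd hj' (by decide)

omit [Fintype E] [DecidableEq E] in
/-- A one-sided core point is core-free. -/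
theorem CoreBase.coreFree_coreReal (hb : CoreBase ends ζ h u H A pure) {ω : Config ι}
    (hω : ¬ (uRed ends A u pure ω ∧ uRed ends A u pure (flipAll ω))) :
    CoreFree ends (coreReal ends A ζ ω) h := by
  intro x hx hx'
  rw [hb.cluster_coreReal, mem_redSet_iff] at hx
  rw [hb.cluster_blue_coreReal, mem_redSet_iff] at hx'
  have key : ∀ i j, ω i = true → flipAll ω j = true → x ∈ A i → x ∈ A j → False := by
    intro i j hi hj hxi hxj
    have : i = j := by
      by_contra hne
      exact hb.arm_disj i j hne x hxi hxj
    subst this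
    simp only [flipAll, hi] at hj
    exact absurd hj (by decide)
  rcases hx with rfl | ⟨i, hi, _, hxi⟩ | ⟨huR, rfl | ⟨i, hi, _, hxi⟩⟩
  · rfl
  · rcases hx' with rfl | ⟨j, hj, _, hxj⟩ | ⟨_, rfl | ⟨j, hj, _, hxj⟩⟩
    · rfl
    · exact (key i j hi hj hxi hxj).elim
    · exact (hb.u_notMem_arm i hxi).elim
    · exact (key i j hi hj hxi hxj).elim
  · rcases hx' with rfl | ⟨j, _, _, hxj⟩ | ⟨huB, _⟩
    · rfl
    · exact (hb.u_notMem_arm j hxj).elim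
    · exact (hω ⟨huR, huB⟩).elim
  · rcases hx' with rfl | ⟨j, hj, _, hxj⟩ | ⟨_, rfl | ⟨j, hj, _, hxj⟩⟩
    · rfl
    · exact (key i j hi hj hxi hxj).elim
    · exact (hb.u_notMem_arm i hxi).elim
    · exact (key i j hi hj hxi hxj).elim

end CoreFree

end LocRows

end Summit.Ventures.PercRepro2
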